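import Summits.Ventures.HSemireg.DerivedDescentCommShift
import HarnessLib

/-!
# Descent of a NATURAL TRANSFORMATION of quasi-isomorphism-preserving endofunctors, and its action on shifted Homs

Cell `pub-hsemireg`, general-structure seat gs-g4; step (I2) (generic half) of general-structure/SIGMA-INVARIANCE-PLAN-gs-g4.md.
Sequel to p3's `DerivedDescent.lean` (`derivedLift`, `derivedLiftFac`, `shiftedHomMap`) and `DerivedDescentCommShift.lean`
(`natTrans_commShift_liftNatTrans`, `whiskerLeft_liftNatTrans`). HONEST FRAMING: generic Mathlib plumbing over an arbitrary abelian
category with a derived category — NOT a door, NOT a named fact, NOT a «K2 result»; nothing here says HC, HC_CM or HC_AV is proved.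

CONTENTS (all proved; Mathlib + tree only). For `τ : Φ₁ ⟶ Φ₂` between endofunctors of `CochainComplex C ℤ` which (followed by
`Q`) invert quasi-isomorphisms:
* `derivedLiftNatTrans hΦ₁ hΦ₂ τ : derivedLift Φ₁ ⟶ derivedLift Φ₂` (Mathlib `Localization.liftNatTrans` along `Q`), with
  `derivedLiftFac_inv_app_comp_derivedLiftNatTrans_app` (its defining compatibility with the factorisations `Q ⋙ derivedLift Φᵢ ≅ Φᵢ ⋙ Q`);
* `derivedLiftNatTrans_commShift` — it commutes with shifts when `τ` does (p3's `natTrans_commShift_liftNatTrans`);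
* **`shiftedHomMap_comp_shift_map`** — naturality of `shiftedHomMap` in the functor: for `y : Q K ⟶ (Q L)⟦n⟧`,
  `Φ₁_*(y) ≫ (Q τ_L)⟦n⟧' = Q τ_K ≫ Φ₂_*(y)`. Intended instance: `τ = 𝓗om•(f, –) : 𝓗om•(K₂•, –) ⟶ 𝓗om•(K₁•, –)` for a chain map
  `f : K₁• ⟶ K₂•` (Mathlib `map₂CochainComplex.flip.map`, which carries `NatTrans.CommShift`), moving `𝓗om•(f, –)` past `Φ_K` in `σ_q^C`.

## References
* Mathlib: `CategoryTheory.Localization.liftNatTrans`, `NatTrans.CommShift` (`NatTrans.shift_app_comm`); folklore.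
-/

noncomputable section

open CategoryTheory CategoryTheory.Category

namespace Summit.Ventures.HSemireg

universe w' v' u'

variable {C : Type u'} [Category.{v'} C] [Abelian C] [HasDerivedCategory.{w'} C]
  {Φ₁ Φ₂ : CochainComplex C ℤ ⥤ CochainComplex C ℤ}
  (hΦ₁ : (HomologicalComplex.quasiIso C (ComplexShape.up ℤ)).IsInvertedBy (Φ₁ ⋙ DerivedCategory.Q))
  (hΦ₂ : (HomologicalComplex.quasiIso C (ComplexShape.up ℤ)).IsInvertedBy (Φ₂ ⋙ DerivedCategory.Q))
  (τ : Φ₁ ⟶ Φ₂)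

/-- **Descent of a natural transformation**: `τ : Φ₁ ⟶ Φ₂` induces `derivedLift Φ₁ ⟶ derivedLift Φ₂`
(Mathlib `Localization.liftNatTrans` along `Q`, applied to `τ ◫ Q`). [folklore] -/
def derivedLiftNatTrans : derivedLift Φ₁ hΦ₁ ⟶ derivedLift Φ₂ hΦ₂ :=
  Localization.liftNatTrans DerivedCategory.Q (HomologicalComplex.quasiIso C (ComplexShape.up ℤ))
    (Φ₁ ⋙ DerivedCategory.Q) (Φ₂ ⋙ DerivedCategory.Q) (derivedLift Φ₁ hΦ₁) (derivedLift Φ₂ hΦ₂)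
    (Functor.whiskerRight τ DerivedCategory.Q)

/-- The defining compatibility on objects `Q K`: `(derivedLiftNatTrans τ)_{Q K} = fac₁.hom_K ≫ Q τ_K ≫ fac₂.inv_K`. [folklore] -/
lemma derivedLiftNatTrans_app (K : CochainComplex C ℤ) :
    (derivedLiftNatTrans hΦ₁ hΦ₂ τ).app (DerivedCategory.Q.obj K) =
      (derivedLiftFac Φ₁ hΦ₁).hom.app K ≫ DerivedCategory.Q.map (τ.app K) ≫ (derivedLiftFac Φ₂ hΦ₂).inv.app K := by
  have h := congrArg (fun α => NatTrans.app α K) (whiskerLeft_liftNatTrans DerivedCategory.Q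
    (HomologicalComplex.quasiIso C (ComplexShape.up ℤ)) (Φ₁ ⋙ DerivedCategory.Q) (Φ₂ ⋙ DerivedCategory.Q)
    (derivedLift Φ₁ hΦ₁) (derivedLift Φ₂ hΦ₂) (Functor.whiskerRight τ DerivedCategory.Q))
  simp only [Functor.whiskerLeft_app, NatTrans.comp_app, Functor.whiskerRight_app] at h
  exact h

section CommShift

variable [Φ₁.CommShift ℤ] [Φ₂.CommShift ℤ] [NatTrans.CommShift τ ℤ]

/-- The descended natural transformation commutes with shifts when `τ` does (p3's `natTrans_commShift_liftNatTrans`; the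
factorisation isomorphisms are shift-compatible by Mathlib `NatTrans.commShift_iso_hom_of_localization`). [folklore] -/
instance derivedLiftNatTrans_commShift : NatTrans.CommShift (derivedLiftNatTrans hΦ₁ hΦ₂ τ) ℤ :=
  natTrans_commShift_liftNatTrans _ _ _ _ _ _ _ _

set_option backward.isDefEq.respectTransparency false in
/-- **Naturality of `shiftedHomMap` in the functor**: for `y : Q K ⟶ (Q L)⟦n⟧` and `τ : Φ₁ ⟶ Φ₂` commuting with shifts,
`Φ₁_*(y) ≫ (Q τ_L)⟦n⟧' = Q τ_K ≫ Φ₂_*(y)` (the seams `(Φ ⋙ Q).obj K` / `Q.obj (Φ.obj K)` are crossed with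
`backward.isDefEq.respectTransparency false`, statement-neutral). [folklore] -/
theorem shiftedHomMap_comp_shift_map {K L : CochainComplex C ℤ} {n : ℤ}
    (y : ShiftedHom (DerivedCategory.Q.obj K) (DerivedCategory.Q.obj L) n) :
    shiftedHomMap Φ₁ hΦ₁ y ≫ (DerivedCategory.Q.map (τ.app L))⟦n⟧' =
      DerivedCategory.Q.map (τ.app K) ≫ shiftedHomMap Φ₂ hΦ₂ y := by
  -- `Q τ_K = fac₁.inv_K ≫ τ'_{Q K} ≫ fac₂.hom_K` and `Q τ_L` likewise, with `τ' := derivedLiftNatTrans τ`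
  have hK : DerivedCategory.Q.map (τ.app K) =
      (derivedLiftFac Φ₁ hΦ₁).inv.app K ≫ (derivedLiftNatTrans hΦ₁ hΦ₂ τ).app (DerivedCategory.Q.obj K) ≫
        (derivedLiftFac Φ₂ hΦ₂).hom.app K := by
    rw [derivedLiftNatTrans_app]
    simp only [assoc, Iso.inv_hom_id_app, Iso.inv_hom_id_app_assoc]
    erw [comp_id]
  have hL : DerivedCategory.Q.map (τ.app L) =
      (derivedLiftFac Φ₁ hΦ₁).inv.app L ≫ (derivedLiftNatTrans hΦ₁ hΦ₂ τ).app (DerivedCategory.Q.obj L) ≫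
        (derivedLiftFac Φ₂ hΦ₂).hom.app L := by
    rw [derivedLiftNatTrans_app]
    simp only [assoc, Iso.inv_hom_id_app, Iso.inv_hom_id_app_assoc]
    erw [comp_id]
  rw [hK, hL, shiftedHomMap, shiftedHomMap, ShiftedHom.map, ShiftedHom.map]
  simp only [Functor.map_comp, assoc]
  rw [← Functor.map_comp_assoc (shiftFunctor (DerivedCategory C) n) ((derivedLiftFac Φ₁ hΦ₁).hom.app L)
      ((derivedLiftFac Φ₁ hΦ₁).inv.app L), Iso.hom_inv_id_app, CategoryTheory.Functor.map_id, id_comp,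
    NatTrans.shift_app_comm_assoc, NatTrans.naturality_assoc, Iso.hom_inv_id_app_assoc]

end CommShift

end Summit.Ventures.HSemireg

end
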